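import Literature.Geometry.Lorentzian.BilinPullbackEstimates
import Mathlib.Analysis.Calculus.MeanValue
import HarnessLib

/-!
# Route ClusterCompleteness · crux `OmegaLimitMultiKerr` — the translates of a tame field are
# Lipschitz in time in `Cᵏ(K)` (the uniform-continuity input of Barbalat's lemma)

Structure lemma for the crux stmt-FinalStateConjecture-14664
(`ClusterCompleteness.OmegaLimitMultiKerr`, rank 9), line `Sketch`, lead gen 5. The LaSalle /
ω-limit reading of recurrence studies the late-time TRANSLATES `x ↦ h (x + t • e)` of a chart field
`h : E → W` (the metric deviation of a late chart, `C^{k+1}` on an open domain `O`) along a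
translation vector `e` (the Killing translation of the boosted Kerr background), with convergence
measured in the `Cᵏ` sup norms `supCkENorm K k` on compacts. Barbalat's lemma
(`barbalat_tendsto_zero`: uniformly continuous + integrable ⇒ `→ 0`) is fed with fluxes
`t ↦ Φ (h (· + t • e))`; their uniform continuity in `t` must come from TAMENESS — all-time
`C^{k+1}` bounds — alone. This file is that input:

* `supCkENorm_translate_sub_translate_le` (the registered stub, closed form) — if the derivatives of
  orders `1, …, k + 1` of `h` are bounded by `Λ` on the swept segments
  `{x + τ • e : x ∈ K, τ ∈ [t, t']} ⊆ O`, then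
  `‖h (· + t • e) − h (· + t' • e)‖_{Cᵏ(K)} ≤ Λ ‖e‖ |t − t'|`: for `m ≤ k` the path
  `τ ↦ Dᵐh (x + τ • e)` has velocity `D^{m+1}h (x + τ • e) · e`, of norm `≤ Λ ‖e‖`, and the mean
  value inequality on `[t, t']` applies (Dieudonné, *Foundations*, (8.5.4); Mathlib's
  `Convex.norm_image_sub_le_of_norm_hasDerivWithin_le`);
* `lipschitzOnWith_comp_translate`, `uniformContinuousOn_comp_translate` — consequently a
  functional `Φ` which is `C`-Lipschitz with respect to `supCkENorm K k` along the translates is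
  Lipschitz, hence uniformly continuous, in `t` on every ray `[a, ∞)` on which the derivatives of
  orders `1, …, k + 1` of `h` are bounded on `K + [a, ∞) e` (the form consumed by
  `barbalat_tendsto_zero`).

Everything is proved; Mathlib + `Literature` only.
-/

-- every `Summit.FinalStateConjecture.FinalStateConjecture.…` name repeats the summit = sub-problem segment (D-0017 layout)
set_option linter.dupNamespace false

noncomputable section

open Set Filter Topology Function
open scoped ContDiff Topology ENNReal

namespace Summit.FinalStateConjecture.FinalStateConjecture.Theorems.ClusterCompleteness

open Literature.Geometry.Lorentzian

/-- **Registered structure stub (crux stmt-FinalStateConjecture-14664, line `Sketch`): the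
translates of a tame field are Lipschitz in time in `Cᵏ(K)`.** Let `h` be `C^{k+1}` on the open set
`O`, and suppose the segments `{x + τ • e : τ ∈ [t, t']}`, `x ∈ K`, lie in `O` and the derivatives
of `h` of orders `1, …, k + 1` are bounded by `Λ` on them. Then
`supCkENorm K k (h (· + t • e) − h (· + t' • e)) ≤ Λ ‖e‖ |t − t'|`: for `m ≤ k` and `x ∈ K`,
`Dᵐ(h (· + t • e) − h (· + t' • e))(x) = Dᵐh (x + t • e) − Dᵐh (x + t' • e)` (translation commutes
with derivatives), the path `τ ↦ Dᵐh (x + τ • e)` has velocity `D^{m+1}h (x + τ • e) · e` of norm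
`≤ Λ ‖e‖`, and the mean value inequality on `[t, t']` concludes. Closed form. [folklore] -/
theorem supCkENorm_translate_sub_translate_le :
    ∀ {E : Type*} [NormedAddCommGroup E] [NormedSpace ℝ E]
      {W : Type*} [NormedAddCommGroup W] [NormedSpace ℝ W]
      {O : Set E}, IsOpen O → ∀ {k : ℕ} {h : E → W}, ContDiffOn ℝ (k + 1) h O →
      ∀ {K : Set E} {e : E} {t t' Λ : ℝ},
      (∀ x ∈ K, ∀ τ ∈ Set.uIcc t t', x + τ • e ∈ O) →
      (∀ i, 1 ≤ i → i ≤ k + 1 → ∀ x ∈ K, ∀ τ ∈ Set.uIcc t t',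
        ‖iteratedFDeriv ℝ i h (x + τ • e)‖ ≤ Λ) →
      supCkENorm K k (fun x ↦ h (x + t • e) - h (x + t' • e)) ≤
        ENNReal.ofReal (Λ * ‖e‖ * |t - t'|) := by
  intro E _ _ W _ _ O hO k h hh K e t t' Λ hseg hb
  refine supCkENorm_le_ofReal fun m hm x hx ↦ ?_
  -- `h` is `C^{k+1}` at every point of the swept segment through `x`
  have hct : ∀ τ ∈ uIcc t t', ContDiffAt ℝ (k + 1) h (x + τ • e) := fun τ hτ ↦
    hh.contDiffAt (hO.mem_nhds (hseg x hx τ hτ))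
  -- hence its translates are `Cᵐ` at `x`
  have htr : ∀ τ ∈ uIcc t t', ContDiffAt ℝ m (fun y ↦ h (y + τ • e)) x := fun τ hτ ↦
    ContDiffAt.comp (g := h) (f := fun y ↦ y + τ • e) x
      ((hct τ hτ).of_le (by exact_mod_cast Nat.le_succ_of_le hm))
      (contDiffAt_id.add contDiffAt_const)
  -- the `m`-th derivative of the difference of two translates, at `x`
  have hdiff : iteratedFDeriv ℝ m (fun y ↦ h (y + t • e) - h (y + t' • e)) x =
      iteratedFDeriv ℝ m h (x + t • e) - iteratedFDeriv ℝ m h (x + t' • e) := by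
    rw [fun_iteratedFDeriv_sub_apply (htr t left_mem_uIcc) (htr t' right_mem_uIcc),
      iteratedFDeriv_comp_add_right, iteratedFDeriv_comp_add_right]
  rw [hdiff]
  -- the path `τ ↦ Dᵐh (x + τ • e)` has velocity `D^{m+1}h (x + τ • e) · e` …
  have hderiv : ∀ τ ∈ uIcc t t', HasDerivAt (fun σ : ℝ ↦ iteratedFDeriv ℝ m h (x + σ • e))
      (fderiv ℝ (iteratedFDeriv ℝ m h) (x + τ • e) e) τ := by
    intro τ hτ
    have h1 : HasDerivAt (fun σ : ℝ ↦ x + σ • e) e τ := by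
      simpa only [one_smul] using ((hasDerivAt_id' τ).smul_const e).const_add x
    have h2 : HasFDerivAt (iteratedFDeriv ℝ m h)
        (fderiv ℝ (iteratedFDeriv ℝ m h) (x + τ • e)) (x + τ • e) :=
      ((hct τ hτ).differentiableAt_iteratedFDeriv
        (by exact_mod_cast Nat.lt_succ_of_le hm)).hasFDerivAt
    exact h2.comp_hasDerivAt τ h1
  -- … of norm `≤ Λ ‖e‖`
  have hbound : ∀ τ ∈ uIcc t t', ‖fderiv ℝ (iteratedFDeriv ℝ m h) (x + τ • e) e‖ ≤ Λ * ‖e‖ := by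
    intro τ hτ
    refine (ContinuousLinearMap.le_opNorm _ _).trans ?_
    rw [norm_fderiv_iteratedFDeriv]
    exact mul_le_mul_of_nonneg_right
      (hb (m + 1) (Nat.succ_le_succ (Nat.zero_le m)) (Nat.succ_le_succ hm) x hx τ hτ)
      (norm_nonneg e)
  -- mean value inequality on the segment `[t, t']`
  have hmv := (convex_uIcc t t').norm_image_sub_le_of_norm_hasDerivWithin_le
    (fun τ hτ ↦ (hderiv τ hτ).hasDerivWithinAt) hbound right_mem_uIcc left_mem_uIcc
  rwa [Real.norm_eq_abs] at hmv

/-- **Tame translates give Lipschitz fluxes** (the uniform-continuity input of Barbalat's lemma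
`barbalat_tendsto_zero`, in Lipschitz form). Let `h` be `C^{k+1}` on the open set `O`; suppose the
rays `{x + τ • e : a ≤ τ}`, `x ∈ K`, lie in `O` and the derivatives of `h` of orders `1, …, k + 1`
are bounded by `Λ` on them (tameness), and let `Φ` be a functional with
`dist (Φ (h (· + t • e))) (Φ (h (· + t' • e))) ≤ C · ‖h (· + t • e) − h (· + t' • e)‖_{Cᵏ(K)}` for
`t, t' ≥ a`, `0 ≤ C`. Then `t ↦ Φ (h (· + t • e))` is `C Λ ‖e‖`-Lipschitz on `[a, ∞)`
(`supCkENorm_translate_sub_translate_le` on the segments `[t, t'] ⊆ [a, ∞)`). [folklore] -/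
theorem lipschitzOnWith_comp_translate {E : Type*} [NormedAddCommGroup E] [NormedSpace ℝ E]
    {W : Type*} [NormedAddCommGroup W] [NormedSpace ℝ W] {β : Type*} [PseudoMetricSpace β]
    {O : Set E} (hO : IsOpen O) {k : ℕ} {h : E → W} (hh : ContDiffOn ℝ (k + 1) h O)
    {K : Set E} {e : E} {a Λ C : ℝ} (hray : ∀ x ∈ K, ∀ τ, a ≤ τ → x + τ • e ∈ O)
    (hb : ∀ i, 1 ≤ i → i ≤ k + 1 → ∀ x ∈ K, ∀ τ, a ≤ τ → ‖iteratedFDeriv ℝ i h (x + τ • e)‖ ≤ Λ)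
    (Φ : (E → W) → β) (hC : 0 ≤ C)
    (hΦ : ∀ t t', a ≤ t → a ≤ t' →
      dist (Φ (fun x ↦ h (x + t • e))) (Φ (fun x ↦ h (x + t' • e))) ≤
        C * (supCkENorm K k (fun x ↦ h (x + t • e) - h (x + t' • e))).toReal) :
    LipschitzOnWith (Real.toNNReal (C * (Λ * ‖e‖))) (fun t ↦ Φ (fun x ↦ h (x + t • e)))
      (Ici a) := by
  refine LipschitzOnWith.of_dist_le_mul fun t ht t' ht' ↦ (hΦ t t' ht ht').trans ?_
  -- the segment `[t, t']`, `t, t' ≥ a`, lies on the ray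
  have hseg : ∀ τ ∈ uIcc t t', a ≤ τ := fun τ hτ ↦ (le_min ht ht').trans hτ.1
  have hle : supCkENorm K k (fun x ↦ h (x + t • e) - h (x + t' • e)) ≤
      ENNReal.ofReal (Λ * ‖e‖ * |t - t'|) :=
    supCkENorm_translate_sub_translate_le hO hh (fun x hx τ hτ ↦ hray x hx τ (hseg τ hτ))
      fun i hi hik x hx τ hτ ↦ hb i hi hik x hx τ (hseg τ hτ)
  rcases K.eq_empty_or_nonempty with rfl | ⟨x, hx⟩
  · -- no points: the `Cᵏ` sup norm over `∅` vanishes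
    have h0 : supCkENorm (∅ : Set E) k (fun x ↦ h (x + t • e) - h (x + t' • e)) = 0 :=
      le_antisymm (supCkENorm_le_of_forall_le fun _ _ x hx ↦ (notMem_empty x hx).elim) zero_le
    rw [h0, ENNReal.toReal_zero, mul_zero]
    positivity
  · -- a point of `K` makes `Λ ≥ 0`
    have hΛ : 0 ≤ Λ :=
      (norm_nonneg _).trans (hb 1 le_rfl (Nat.succ_le_succ (Nat.zero_le k)) x hx a le_rfl)
    have hnn : 0 ≤ Λ * ‖e‖ * |t - t'| := by positivity
    calc C * (supCkENorm K k (fun x ↦ h (x + t • e) - h (x + t' • e))).toReal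
        ≤ C * (Λ * ‖e‖ * |t - t'|) :=
          mul_le_mul_of_nonneg_left (ENNReal.toReal_le_of_le_ofReal hnn hle) hC
      _ = (Real.toNNReal (C * (Λ * ‖e‖)) : ℝ) * dist t t' := by
          rw [Real.coe_toNNReal _ (by positivity), Real.dist_eq]
          ring

/-- **Tame translates give uniformly continuous fluxes**: under the hypotheses of
`lipschitzOnWith_comp_translate`, `t ↦ Φ (h (· + t • e))` is uniformly continuous on `[a, ∞)` — the
hypothesis of Barbalat's lemma `barbalat_tendsto_zero` (uniformly continuous + integrable on
`[a, ∞)` ⇒ `→ 0`), obtained from tameness alone. [folklore] -/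
theorem uniformContinuousOn_comp_translate {E : Type*} [NormedAddCommGroup E] [NormedSpace ℝ E]
    {W : Type*} [NormedAddCommGroup W] [NormedSpace ℝ W] {β : Type*} [PseudoMetricSpace β]
    {O : Set E} (hO : IsOpen O) {k : ℕ} {h : E → W} (hh : ContDiffOn ℝ (k + 1) h O)
    {K : Set E} {e : E} {a Λ C : ℝ} (hray : ∀ x ∈ K, ∀ τ, a ≤ τ → x + τ • e ∈ O)
    (hb : ∀ i, 1 ≤ i → i ≤ k + 1 → ∀ x ∈ K, ∀ τ, a ≤ τ → ‖iteratedFDeriv ℝ i h (x + τ • e)‖ ≤ Λ)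
    (Φ : (E → W) → β) (hC : 0 ≤ C)
    (hΦ : ∀ t t', a ≤ t → a ≤ t' →
      dist (Φ (fun x ↦ h (x + t • e))) (Φ (fun x ↦ h (x + t' • e))) ≤
        C * (supCkENorm K k (fun x ↦ h (x + t • e) - h (x + t' • e))).toReal) :
    UniformContinuousOn (fun t ↦ Φ (fun x ↦ h (x + t • e))) (Ici a) :=
  (lipschitzOnWith_comp_translate hO hh hray hb Φ hC hΦ).uniformContinuousOn

end Summit.FinalStateConjecture.FinalStateConjecture.Theorems.ClusterCompleteness

end
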